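import Literature.NumberTheory.Automorphic.UnitaryGroupHeisenbergPartTorusPush
import HarnessLib

/-!
# The Heisenberg part of the unipotent term, torus stage ⇒ idelic stage WITHOUT a torus-side integrability input:
# the finiteness is Tate's
(Rogawski, *Automorphic Representations of Unitary Groups in Three Variables* (1990), proof of Prop. 7.3.2, p. 97, last two
displays; Tate, in Cassels–Fröhlich, Ch. XV, Thm. 4.4.1: the truncated zeta integrand is absolutely integrable over
`E^×∖𝕀_E` for every positive truncation parameter.)

Topic `NumberTheory/Automorphic`; namespace `Literature.NumberTheory.Automorphic.UnitaryGroup`. THEOREMS ONLY over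
accepted tree modules (no definition, no named fact, no instance, no notation, no `sorry`). Leaf (ET-δ) of row (E-T) of item
(L5-i) «the unipotent term `P_{z·𝒰}`» of the T1-qs LAW 5 road of `Cruxes/H413/Lines/F0_T1InnerFormTraceIdentity.lean` (cell
`pub/hodgecm-mathlib`, crux H413), THRESHOLD FORM: the same push + inversion as ★ `torusStage_eq_mul_setIntegral_tateIntegrand'`
(`UnitaryGroupHeisenbergPartTorusPush`), but

* the normal form `hΘ` (★ (ET-γ) `torusIntegrand_heisPart_normalForm`) is only asked above a threshold `T₀` (and `0 < T`
  follows), and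
* the torus-side integrability hypothesis `hint` is DROPPED: the finiteness `∫⁻ w_T(t) ‖G_T((α₁ t)⁻¹)‖ dμ_T < ∞` needed by
  the Bochner bridge is read, through the `[0, ∞]` push ★ `exists_lintegral_comp_diagUnitRatio_mul_weight_eq_setLIntegral`
  and the inversion `x ↦ x⁻¹`, off TATE'S absolute integrability of the truncated integrand on the idele class domain (★
  `integrableOn_and_setIntegral_tateTruncated_haar`, first conjunct) — so the (E) closer owes nothing on the torus side.

OUTPUT **`torusStage_eq_mul_setIntegral_tateIntegrand_of_threshold`**: `∃ C ∈ (0,∞), ∀ T > T₀,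
∫ w_T δ_B⁻¹ Θ_T dμ_T = μ_X(D_E) · C · ∫_{𝓕_E} G_T dν_I` — the binder `hET` of ★ `heisPart_integral_eq_linear_of_stages_tate`.

## References

* J. D. Rogawski, *Automorphic Representations of Unitary Groups in Three Variables*, Annals of Mathematics Studies 123
  (1990), proof of Prop. 7.3.2 (p. 97) [Rogawski1990].
* J. Tate, *Fourier analysis in number fields and Hecke's zeta-functions*, in Cassels–Fröhlich (eds.), *Algebraic Number
  Theory* (1967), Ch. XV, Thm. 4.4.1 [CasselsFrohlichANT1967].
* G. B. Folland, *A Course in Abstract Harmonic Analysis* (1995), §2.6 Thm. 2.49 [Folland1995].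
-/

set_option autoImplicit false

noncomputable section

open MeasureTheory MeasureTheory.Measure NumberField IsDedekindDomain Set Filter Literature.MeasureTheory.Group
open scoped ENNReal NNReal
open Literature.NumberTheory.Automorphic.Meyer

namespace Literature.NumberTheory.Automorphic

namespace UnitaryGroup

/-! ## §1 Inversion on the idele group, `[0, ∞]` form -/

section Inversion

variable (E : Type) [Field E] [NumberField E]
  [MeasurableSpace (GaloisRepresentations.ideleGroup E)] [BorelSpace (GaloisRepresentations.ideleGroup E)]
  (νI : Measure (GaloisRepresentations.ideleGroup E)) [νI.IsHaarMeasure]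

/-- **`∫⁻_{𝓕⁻¹} u dν_I = ∫⁻_{𝓕} u(x⁻¹) dν_I`** (Tate's substitution `𝔞 ↦ 𝔞⁻¹` on the unimodular `𝕀_E`, `[0,∞]`-valued form).
[cite: CasselsFrohlichANT1967, Ch. XV Thm. 4.4.1 (proof)] -/
theorem setLIntegral_inv_eq_setLIntegral_comp_inv {s : Set (GaloisRepresentations.ideleGroup E)} (hs : MeasurableSet s)
    (u : GaloisRepresentations.ideleGroup E → ℝ≥0∞) :
    ∫⁻ x in s⁻¹, u x ∂νI = ∫⁻ x in s, u x⁻¹ ∂νI := by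
  haveI := locallyCompactSpace_ideleGroup E
  haveI := secondCountableTopology_ideleGroup E
  haveI := t2Space_ideleGroup E
  haveI : νI.Regular := inferInstance
  haveI : νI.IsInvInvariant := inferInstance
  rw [← lintegral_indicator hs.inv, ← lintegral_indicator hs, ← lintegral_inv_eq_self (μ := νI) (fun x => s⁻¹.indicator u x)]
  refine lintegral_congr fun x => ?_
  show s⁻¹.indicator u x⁻¹ = s.indicator (fun x => u x⁻¹) x
  by_cases hx : x ∈ s
  · rw [Set.indicator_of_mem (Set.inv_mem_inv.2 hx), Set.indicator_of_mem hx]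
  · rw [Set.indicator_of_notMem (fun h => hx (Set.inv_mem_inv.1 h)), Set.indicator_of_notMem hx]

end Inversion

/-! ## §2 The push above a threshold, finiteness from Tate -/

section Push

variable {F E : Type} [Field F] [NumberField F] [Field E] [NumberField E] [Algebra F E] {c : E ≃ₐ[F] E}
  [MeasurableSpace (quasiSplit F E c 3).Adelic] [BorelSpace (quasiSplit F E c 3).Adelic]
  [MeasurableSpace (AdeleRing (𝓞 E) E)] [BorelSpace (AdeleRing (𝓞 E) E)]
  [MeasurableSpace (GaloisRepresentations.ideleGroup E)] [BorelSpace (GaloisRepresentations.ideleGroup E)]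

/-- **TORUS STAGE ⇒ IDELIC STAGE ABOVE A THRESHOLD, FINITENESS FROM TATE** [Rogawski1990, p. 97, the last two displays before
«Lemma 7.1.1 can be applied»; CasselsFrohlichANT1967 Ch. XV Thm. 4.4.1 for the absolute integrability].
For `[E : F] = 2`, `c² = 1`, `c ≠ 1`, Haar measures `μ_T` of `T(𝔸_F)` and `ν_I` of `𝕀_E`, a covering weight `w_T` of the
rational torus, an idele class domain `𝓕_E`, `ψ ∈ 𝒮(𝔸_E)`, `H₁ > 0`, and a torus integrand `Θ_T` in NORMAL FORM
`δ_B(t)⁻¹ Θ_T(t) = μ_X(D_E) · G_T((α₁ t)⁻¹)` (leaf (ET-γ); `G_T` = Tate's truncated integrand at the cut-off `(T∕H₁)⁻¹`) for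
`T > T₀`: there is `C ∈ (0, ∞)` (the push constant of ★
`exists_lintegral_comp_diagUnitRatio_mul_weight_eq_setLIntegral`, independent of `T`, `ψ`, `w_T`) with
`∫ w_T(t) δ_B(t)⁻¹ Θ_T(t) dμ_T = μ_X(D_E) · C · ∫_{𝓕_E} G_T dν_I` for every `T > T₀` — the binder `hET` of ★
`heisPart_integral_eq_linear_of_stages_tate` with `C₂ = μ_X(D_E) · C`. No torus-side integrability is
assumed: the finiteness the Bochner bridge needs is Tate's (§1 + ★ `integrableOn_and_setIntegral_tateTruncated_haar`).
[cite: Rogawski1990, Prop. 7.3.2 (pp. 96–97)] [cite: CasselsFrohlichANT1967, Ch. XV Thm. 4.4.1]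
[cite: Folland1995, §2.6 Thm. 2.49] -/
theorem torusStage_eq_mul_setIntegral_tateIntegrand_of_threshold (h2 : Module.finrank F E = 2) (hc : c * c = 1) (hc1 : c ≠ 1)
    (μT : Measure (torusInBorel F E c 3)) [IsHaarMeasure μT]
    (μX : Measure (AdeleRing (𝓞 E) E)) [μX.IsAddHaarMeasure]
    (νI : Measure (GaloisRepresentations.ideleGroup E)) [νI.IsHaarMeasure]
    {𝓕E : Set (GaloisRepresentations.ideleGroup E)} (h𝓕 : IsIdeleClassDomain E 𝓕E)
    {wT : torusInBorel F E c 3 → ℝ≥0∞}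
    (hwT : IsCoveringWeight ((rationalBorel F E c 3).subgroupOf (torusInBorel F E c 3)) wT)
    {ψ : AdeleRing (𝓞 E) E → ℂ} (hψ : ψ ∈ schwartzBruhatAdele E) {H₁ : ℝ} (hH₁ : 0 < H₁) (T₀ : ℝ≥0)
    {Θ : ℝ≥0 → torusInBorel F E c 3 → ℂ}
    (hΘ : ∀ (T : ℝ≥0), T₀ < T → ∀ (t : torusInBorel F E c 3),
      ((torusRootModulus E 3 (diagUnit (t : borelAdelic F E c 3).2) : ℝ≥0) : ℝ)⁻¹ • Θ T t =
        (μX.real (adeleFundamentalDomain E) : ℂ) *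
          ((ideleSum E ψ (diagUnit (t : borelAdelic F E c 3).2 0 * (diagUnit (t : borelAdelic F E c 3).2 1)⁻¹)⁻¹ -
              ((IdeleClassGroup.ideleNorm E
                  (diagUnit (t : borelAdelic F E c 3).2 0 * (diagUnit (t : borelAdelic F E c 3).2 1)⁻¹)⁻¹ : ℝ) : ℂ)⁻¹ *
                {y : GaloisRepresentations.ideleGroup E |
                    (IdeleClassGroup.ideleNorm E y : ℝ) < ((T : ℝ) / H₁)⁻¹}.indicator
                  (fun _ => ((μX (adeleFundamentalDomain E)).toReal⁻¹ : ℂ) * adeleFourier E μX ψ 0)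
                  (diagUnit (t : borelAdelic F E c 3).2 0 * (diagUnit (t : borelAdelic F E c 3).2 1)⁻¹)⁻¹) *
            ((IdeleClassGroup.ideleNorm E
                (diagUnit (t : borelAdelic F E c 3).2 0 * (diagUnit (t : borelAdelic F E c 3).2 1)⁻¹)⁻¹ : ℝ) : ℂ)))
    :
    ∃ C : ℝ≥0∞, C ≠ 0 ∧ C ≠ ∞ ∧ ∀ T : ℝ≥0, T₀ < T →
      ∫ t, ((wT t).toReal * ((torusRootModulus E 3 (diagUnit (t : borelAdelic F E c 3).2) : ℝ≥0) : ℝ)⁻¹) • Θ T t ∂μT =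
        ((μX.real (adeleFundamentalDomain E) : ℂ) * (C.toReal : ℂ)) *
          ∫ x in 𝓕E, (ideleSum E ψ x - ((IdeleClassGroup.ideleNorm E x : ℝ) : ℂ)⁻¹ *
              {y : GaloisRepresentations.ideleGroup E |
                  (IdeleClassGroup.ideleNorm E y : ℝ) < ((T : ℝ) / H₁)⁻¹}.indicator
                (fun _ => ((μX (adeleFundamentalDomain E)).toReal⁻¹ : ℂ) * adeleFourier E μX ψ 0) x) *
            ((IdeleClassGroup.ideleNorm E x : ℝ) : ℂ) ∂νI := by
  haveI := locallyCompactSpace_ideleGroup E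
  haveI := secondCountableTopology_ideleGroup E
  haveI := t2Space_ideleGroup E
  -- the push constant
  obtain ⟨C, hC0, hCt, hpush⟩ :=
    exists_lintegral_comp_diagUnitRatio_mul_weight_eq_setLIntegral h2 hc hc1 μT νI
  refine ⟨C, hC0, hCt, fun T hT => ?_⟩
  have hTpos : (0 : ℝ) < (T : ℝ) := by exact_mod_cast pos_of_gt hT
  -- Tate's integrand at the cut-off `(T/H₁)⁻¹`, read at `x⁻¹`
  set G : GaloisRepresentations.ideleGroup E → ℂ := fun x =>
    (ideleSum E ψ x⁻¹ - ((IdeleClassGroup.ideleNorm E x⁻¹ : ℝ) : ℂ)⁻¹ *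
        {y : GaloisRepresentations.ideleGroup E | (IdeleClassGroup.ideleNorm E y : ℝ) < ((T : ℝ) / H₁)⁻¹}.indicator
          (fun _ => ((μX (adeleFundamentalDomain E)).toReal⁻¹ : ℂ) * adeleFourier E μX ψ 0) x⁻¹) *
      ((IdeleClassGroup.ideleNorm E x⁻¹ : ℝ) : ℂ) with hGdef
  have hGm : Measurable G := measurable_tateIntegrand_comp_inv E hψ _ _
  have hGinv : ∀ k ∈ GaloisRepresentations.principalIdeles E, ∀ x, G (k * x) = G x :=
    fun k hk x => tateIntegrand_comp_inv_principal_mul E ψ _ _ hk x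
  -- the torus integrand in terms of `G`
  have hΘ' : ∀ t : torusInBorel F E c 3,
      ((wT t).toReal * ((torusRootModulus E 3 (diagUnit (t : borelAdelic F E c 3).2) : ℝ≥0) : ℝ)⁻¹) • Θ T t =
        (μX.real (adeleFundamentalDomain E) : ℂ) * ((wT t).toReal •
          G (diagUnit (t : borelAdelic F E c 3).2 0 * (diagUnit (t : borelAdelic F E c 3).2 1)⁻¹)) := by
    intro t
    rw [mul_smul, hΘ T hT t, hGdef, Complex.real_smul, Complex.real_smul]
    ring
  -- the `α₁`-measurability and the weight
  have hα : Measurable fun t : torusInBorel F E c 3 =>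
      diagUnit (t : borelAdelic F E c 3).2 0 * (diagUnit (t : borelAdelic F E c 3).2 1)⁻¹ :=
    continuous_diagUnitRatioHom.measurable
  have hwfin : ∀ᵐ t ∂μT, wT t < ∞ := ae_of_all _ fun t => lt_of_le_of_lt (hwT.le_one t) ENNReal.one_lt_top
  have hwne : ∀ t, wT t ≠ ∞ := fun t => (lt_of_le_of_lt (hwT.le_one t) ENNReal.one_lt_top).ne
  -- finiteness on the torus side: Tate's absolute integrability transported by the `[0,∞]` push and inversion
  have hfin : ∫⁻ t, ‖G (diagUnit (t : borelAdelic F E c 3).2 0 * (diagUnit (t : borelAdelic F E c 3).2 1)⁻¹)‖ₑ * wT t ∂μT < ∞ := by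
    rw [hpush wT hwT 𝓕E⁻¹ h𝓕.inv (fun x => ‖G x‖ₑ) hGm.enorm (fun k hk x => by simp only [hGinv k hk x]),
      setLIntegral_inv_eq_setLIntegral_comp_inv E νI h𝓕.measurableSet]
    refine ENNReal.mul_lt_top hCt.lt_top ?_
    have hTate := (integrableOn_and_setIntegral_tateTruncated_haar μX νI h𝓕 hψ (div_pos hTpos hH₁)).1
    have h2' := hTate.2
    rw [hasFiniteIntegral_iff_enorm] at h2'
    refine lt_of_le_of_lt (le_of_eq (lintegral_congr fun x => ?_)) h2'
    simp only [hGdef, inv_inv]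
  -- the push at the idele class domain `𝓕E⁻¹`
  obtain ⟨-, -, hEq⟩ := integrable_and_setIntegral_eq_of_forall_lintegral_comp_mul_eq μT νI 𝓕E⁻¹
    (GaloisRepresentations.principalIdeles E : Set (GaloisRepresentations.ideleGroup E)) hα hwT.measurable hwfin hCt
    (fun u hu huinv => hpush wT hwT 𝓕E⁻¹ h𝓕.inv u hu huinv) hGm hGinv hfin
  -- assemble: pull the constant, push, invert
  calc ∫ t, ((wT t).toReal * ((torusRootModulus E 3 (diagUnit (t : borelAdelic F E c 3).2) : ℝ≥0) : ℝ)⁻¹) • Θ T t ∂μT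
      = ∫ t, (μX.real (adeleFundamentalDomain E) : ℂ) * ((wT t).toReal •
          G (diagUnit (t : borelAdelic F E c 3).2 0 * (diagUnit (t : borelAdelic F E c 3).2 1)⁻¹)) ∂μT :=
        integral_congr_ae (ae_of_all _ fun t => hΘ' t)
    _ = (μX.real (adeleFundamentalDomain E) : ℂ) * ((C.toReal : ℂ) * ∫ x in 𝓕E⁻¹, G x ∂νI) := by
        rw [integral_const_mul, hEq]
    _ = ((μX.real (adeleFundamentalDomain E) : ℂ) * (C.toReal : ℂ)) * ∫ x in 𝓕E, G x⁻¹ ∂νI := by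
        rw [setIntegral_inv_eq_setIntegral_comp_inv E νI h𝓕.measurableSet G, mul_assoc]
    _ = _ := by
        simp only [hGdef, inv_inv]

/-! ## §3 ED. 2: constants first -/

/-- **TORUS STAGE ⇒ IDELIC STAGE, CONSTANTS FIRST** (ED. 2, for the (σ-i) Finset closer: the push constant `C` — Rogawski's
`m(𝐙S′∖𝐒′)` — depends on the Haar measures `μ_T`, `ν_I` only, so it is bound BEFORE the class data `w_T, ψ, H₁, T₀, Θ`;
same proof with the `obtain` hoisted). Original docstring: **TORUS STAGE ⇒ IDELIC STAGE ABOVE A THRESHOLD, FINITENESS FROM TATE** [Rogawski1990, p. 97, the last two displays before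
«Lemma 7.1.1 can be applied»; CasselsFrohlichANT1967 Ch. XV Thm. 4.4.1 for the absolute integrability].
For `[E : F] = 2`, `c² = 1`, `c ≠ 1`, Haar measures `μ_T` of `T(𝔸_F)` and `ν_I` of `𝕀_E`, a covering weight `w_T` of the
rational torus, an idele class domain `𝓕_E`, `ψ ∈ 𝒮(𝔸_E)`, `H₁ > 0`, and a torus integrand `Θ_T` in NORMAL FORM
`δ_B(t)⁻¹ Θ_T(t) = μ_X(D_E) · G_T((α₁ t)⁻¹)` (leaf (ET-γ); `G_T` = Tate's truncated integrand at the cut-off `(T∕H₁)⁻¹`) for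
`T > T₀`: there is `C ∈ (0, ∞)` (the push constant of ★
`exists_lintegral_comp_diagUnitRatio_mul_weight_eq_setLIntegral`, independent of `T`, `ψ`, `w_T`) with
`∫ w_T(t) δ_B(t)⁻¹ Θ_T(t) dμ_T = μ_X(D_E) · C · ∫_{𝓕_E} G_T dν_I` for every `T > T₀` — the binder `hET` of ★
`heisPart_integral_eq_linear_of_stages_tate` with `C₂ = μ_X(D_E) · C`. No torus-side integrability is
assumed: the finiteness the Bochner bridge needs is Tate's (§1 + ★ `integrableOn_and_setIntegral_tateTruncated_haar`).
[cite: Rogawski1990, Prop. 7.3.2 (pp. 96–97)] [cite: CasselsFrohlichANT1967, Ch. XV Thm. 4.4.1]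
[cite: Folland1995, §2.6 Thm. 2.49] -/
theorem exists_const_torusStage_eq_mul_setIntegral_tateIntegrand (h2 : Module.finrank F E = 2) (hc : c * c = 1) (hc1 : c ≠ 1)
    (μT : Measure (torusInBorel F E c 3)) [IsHaarMeasure μT]
    (μX : Measure (AdeleRing (𝓞 E) E)) [μX.IsAddHaarMeasure]
    (νI : Measure (GaloisRepresentations.ideleGroup E)) [νI.IsHaarMeasure]
    :
    ∃ C : ℝ≥0∞, C ≠ 0 ∧ C ≠ ∞ ∧ ∀
    {𝓕E : Set (GaloisRepresentations.ideleGroup E)} (h𝓕 : IsIdeleClassDomain E 𝓕E)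
    {wT : torusInBorel F E c 3 → ℝ≥0∞}
    (hwT : IsCoveringWeight ((rationalBorel F E c 3).subgroupOf (torusInBorel F E c 3)) wT)
    {ψ : AdeleRing (𝓞 E) E → ℂ} (hψ : ψ ∈ schwartzBruhatAdele E) {H₁ : ℝ} (hH₁ : 0 < H₁) (T₀ : ℝ≥0)
    {Θ : ℝ≥0 → torusInBorel F E c 3 → ℂ}
    (hΘ : ∀ (T : ℝ≥0), T₀ < T → ∀ (t : torusInBorel F E c 3),
      ((torusRootModulus E 3 (diagUnit (t : borelAdelic F E c 3).2) : ℝ≥0) : ℝ)⁻¹ • Θ T t =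
        (μX.real (adeleFundamentalDomain E) : ℂ) *
          ((ideleSum E ψ (diagUnit (t : borelAdelic F E c 3).2 0 * (diagUnit (t : borelAdelic F E c 3).2 1)⁻¹)⁻¹ -
              ((IdeleClassGroup.ideleNorm E
                  (diagUnit (t : borelAdelic F E c 3).2 0 * (diagUnit (t : borelAdelic F E c 3).2 1)⁻¹)⁻¹ : ℝ) : ℂ)⁻¹ *
                {y : GaloisRepresentations.ideleGroup E |
                    (IdeleClassGroup.ideleNorm E y : ℝ) < ((T : ℝ) / H₁)⁻¹}.indicator
                  (fun _ => ((μX (adeleFundamentalDomain E)).toReal⁻¹ : ℂ) * adeleFourier E μX ψ 0)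
                  (diagUnit (t : borelAdelic F E c 3).2 0 * (diagUnit (t : borelAdelic F E c 3).2 1)⁻¹)⁻¹) *
            ((IdeleClassGroup.ideleNorm E
                (diagUnit (t : borelAdelic F E c 3).2 0 * (diagUnit (t : borelAdelic F E c 3).2 1)⁻¹)⁻¹ : ℝ) : ℂ))),
    ∀ T : ℝ≥0, T₀ < T →
      ∫ t, ((wT t).toReal * ((torusRootModulus E 3 (diagUnit (t : borelAdelic F E c 3).2) : ℝ≥0) : ℝ)⁻¹) • Θ T t ∂μT =
        ((μX.real (adeleFundamentalDomain E) : ℂ) * (C.toReal : ℂ)) *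
          ∫ x in 𝓕E, (ideleSum E ψ x - ((IdeleClassGroup.ideleNorm E x : ℝ) : ℂ)⁻¹ *
              {y : GaloisRepresentations.ideleGroup E |
                  (IdeleClassGroup.ideleNorm E y : ℝ) < ((T : ℝ) / H₁)⁻¹}.indicator
                (fun _ => ((μX (adeleFundamentalDomain E)).toReal⁻¹ : ℂ) * adeleFourier E μX ψ 0) x) *
            ((IdeleClassGroup.ideleNorm E x : ℝ) : ℂ) ∂νI := by
  haveI := locallyCompactSpace_ideleGroup E
  haveI := secondCountableTopology_ideleGroup E
  haveI := t2Space_ideleGroup E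
  -- the push constant
  obtain ⟨C, hC0, hCt, hpush⟩ :=
    exists_lintegral_comp_diagUnitRatio_mul_weight_eq_setLIntegral h2 hc hc1 μT νI
  refine ⟨C, hC0, hCt, ?_⟩
  intro 𝓕E h𝓕 wT hwT ψ hψ H₁ hH₁ T₀ Θ hΘ T hT
  have hTpos : (0 : ℝ) < (T : ℝ) := by exact_mod_cast pos_of_gt hT
  -- Tate's integrand at the cut-off `(T/H₁)⁻¹`, read at `x⁻¹`
  set G : GaloisRepresentations.ideleGroup E → ℂ := fun x =>
    (ideleSum E ψ x⁻¹ - ((IdeleClassGroup.ideleNorm E x⁻¹ : ℝ) : ℂ)⁻¹ *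
        {y : GaloisRepresentations.ideleGroup E | (IdeleClassGroup.ideleNorm E y : ℝ) < ((T : ℝ) / H₁)⁻¹}.indicator
          (fun _ => ((μX (adeleFundamentalDomain E)).toReal⁻¹ : ℂ) * adeleFourier E μX ψ 0) x⁻¹) *
      ((IdeleClassGroup.ideleNorm E x⁻¹ : ℝ) : ℂ) with hGdef
  have hGm : Measurable G := measurable_tateIntegrand_comp_inv E hψ _ _
  have hGinv : ∀ k ∈ GaloisRepresentations.principalIdeles E, ∀ x, G (k * x) = G x :=
    fun k hk x => tateIntegrand_comp_inv_principal_mul E ψ _ _ hk x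
  -- the torus integrand in terms of `G`
  have hΘ' : ∀ t : torusInBorel F E c 3,
      ((wT t).toReal * ((torusRootModulus E 3 (diagUnit (t : borelAdelic F E c 3).2) : ℝ≥0) : ℝ)⁻¹) • Θ T t =
        (μX.real (adeleFundamentalDomain E) : ℂ) * ((wT t).toReal •
          G (diagUnit (t : borelAdelic F E c 3).2 0 * (diagUnit (t : borelAdelic F E c 3).2 1)⁻¹)) := by
    intro t
    rw [mul_smul, hΘ T hT t, hGdef, Complex.real_smul, Complex.real_smul]
    ring
  -- the `α₁`-measurability and the weight
  have hα : Measurable fun t : torusInBorel F E c 3 =>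
      diagUnit (t : borelAdelic F E c 3).2 0 * (diagUnit (t : borelAdelic F E c 3).2 1)⁻¹ :=
    continuous_diagUnitRatioHom.measurable
  have hwfin : ∀ᵐ t ∂μT, wT t < ∞ := ae_of_all _ fun t => lt_of_le_of_lt (hwT.le_one t) ENNReal.one_lt_top
  have hwne : ∀ t, wT t ≠ ∞ := fun t => (lt_of_le_of_lt (hwT.le_one t) ENNReal.one_lt_top).ne
  -- finiteness on the torus side: Tate's absolute integrability transported by the `[0,∞]` push and inversion
  have hfin : ∫⁻ t, ‖G (diagUnit (t : borelAdelic F E c 3).2 0 * (diagUnit (t : borelAdelic F E c 3).2 1)⁻¹)‖ₑ * wT t ∂μT < ∞ := by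
    rw [hpush wT hwT 𝓕E⁻¹ h𝓕.inv (fun x => ‖G x‖ₑ) hGm.enorm (fun k hk x => by simp only [hGinv k hk x]),
      setLIntegral_inv_eq_setLIntegral_comp_inv E νI h𝓕.measurableSet]
    refine ENNReal.mul_lt_top hCt.lt_top ?_
    have hTate := (integrableOn_and_setIntegral_tateTruncated_haar μX νI h𝓕 hψ (div_pos hTpos hH₁)).1
    have h2' := hTate.2
    rw [hasFiniteIntegral_iff_enorm] at h2'
    refine lt_of_le_of_lt (le_of_eq (lintegral_congr fun x => ?_)) h2'
    simp only [hGdef, inv_inv]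
  -- the push at the idele class domain `𝓕E⁻¹`
  obtain ⟨-, -, hEq⟩ := integrable_and_setIntegral_eq_of_forall_lintegral_comp_mul_eq μT νI 𝓕E⁻¹
    (GaloisRepresentations.principalIdeles E : Set (GaloisRepresentations.ideleGroup E)) hα hwT.measurable hwfin hCt
    (fun u hu huinv => hpush wT hwT 𝓕E⁻¹ h𝓕.inv u hu huinv) hGm hGinv hfin
  -- assemble: pull the constant, push, invert
  calc ∫ t, ((wT t).toReal * ((torusRootModulus E 3 (diagUnit (t : borelAdelic F E c 3).2) : ℝ≥0) : ℝ)⁻¹) • Θ T t ∂μT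
      = ∫ t, (μX.real (adeleFundamentalDomain E) : ℂ) * ((wT t).toReal •
          G (diagUnit (t : borelAdelic F E c 3).2 0 * (diagUnit (t : borelAdelic F E c 3).2 1)⁻¹)) ∂μT :=
        integral_congr_ae (ae_of_all _ fun t => hΘ' t)
    _ = (μX.real (adeleFundamentalDomain E) : ℂ) * ((C.toReal : ℂ) * ∫ x in 𝓕E⁻¹, G x ∂νI) := by
        rw [integral_const_mul, hEq]
    _ = ((μX.real (adeleFundamentalDomain E) : ℂ) * (C.toReal : ℂ)) * ∫ x in 𝓕E, G x⁻¹ ∂νI := by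
        rw [setIntegral_inv_eq_setIntegral_comp_inv E νI h𝓕.measurableSet G, mul_assoc]
    _ = _ := by
        simp only [hGdef, inv_inv]

end Push

end UnitaryGroup

end Literature.NumberTheory.Automorphic
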